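import Summits.CriticalPhenomena.CardyFormulaZ2.Theorems.CardyIKTransportCornerLineDescentSyndromeBiasLevel

/-!
# Syndrome bias, part 3/5: the finite claim

Support file for `stub_SyndromeBias` (stmt-CriticalPhenomena-10964): for `p ∈ (0,1)` there is `K = K(p)` such that on
every `(2r+1) × (2r+1)` grid of i.i.d. Bernoulli(`p`) bits, for every cell `f` and every event `E` depending only on
the row and column parities, `|P[f ∈ X, E] - p P[E]| ≤ K |1-2p|^{2r} P[E]` (`sat_bias`, from `level_bias` summed over
level sets; `K = 6 + |1-2p|^{-2r₀}` with `r₀` from `n ρ^n → 0`; exactly `0` at `p = ½`).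
-/

noncomputable section

namespace Summit.CriticalPhenomena.CardyFormulaZ2.Theorems.CornerLineDescent.SymmetricSeed

open scoped BigOperators Classical
open Finset

/-- ANCHOR OF PART 3 (proposed registered sub-goal; Mathlib-only signature). `(1+t)^n ≤ 1/(1-δ)` when `0 ≤ t`, `n t
≤ δ < 1` (from Bernoulli's inequality `(1-t)^n ≥ 1 - nt` and `(1-t²)^n ≤ 1`; replaces `exp` in the eventual bounds).
[folklore] -/
theorem one_add_pow_le_inv_sub : ∀ (t δ : ℝ), 0 ≤ t → ∀ (n : ℕ), (n : ℝ) * t ≤ δ → δ < 1 → (1 + t) ^ n ≤ 1 / (1 - δ) := by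
  intro t δ ht n hn hδ
  have hpos : 0 < 1 - δ := by linarith
  rcases Nat.eq_zero_or_pos n with hn0 | hn0
  · subst hn0
    simp only [Nat.cast_zero, zero_mul] at hn
    rw [pow_zero, le_div_iff₀ hpos]; linarith
  have ht1 : t ≤ δ := by
    have : (1 : ℝ) ≤ n := by exact_mod_cast hn0
    nlinarith
  have hB : 1 + (n : ℝ) * (-t) ≤ (1 + (-t)) ^ n := one_add_mul_le_pow (by linarith) n
  have hP : (1 + t) ^ n * (1 - t) ^ n ≤ 1 := by
    rw [← mul_pow]
    exact pow_le_one₀ (by nlinarith) (by nlinarith)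
  rw [le_div_iff₀ hpos]
  have h3 : 0 ≤ (1 + t) ^ n := by positivity
  calc (1 + t) ^ n * (1 - δ) ≤ (1 + t) ^ n * (1 - n * t) :=
        mul_le_mul_of_nonneg_left (by linarith) h3
    _ ≤ (1 + t) ^ n * (1 - t) ^ n := by
        refine mul_le_mul_of_nonneg_left ?_ h3
        have : (1 : ℝ) + -t = 1 - t := by ring
        rw [this] at hB; linarith
    _ ≤ 1 := hP

namespace SyndromeBias

/-- For `0 ≤ ρ < 1`: eventually `4r ρ^{r-1} ≤ 1/6` and `ρ^{r-1} ≤ 1/48`. [folklore] -/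
theorem eventually_small {ρ : ℝ} (h0 : 0 ≤ ρ) (h1 : ρ < 1) :
    ∃ r₀ : ℕ, ∀ r, r₀ ≤ r → (4 * r : ℝ) * ρ ^ (r - 1) ≤ 1 / 6 ∧ ρ ^ (r - 1) ≤ 1 / 48 := by
  have t1 := tendsto_self_mul_const_pow_of_lt_one h0 h1
  have t2 := tendsto_pow_atTop_nhds_zero_of_lt_one h0 h1
  have e1 : ∀ᶠ n : ℕ in Filter.atTop, (n : ℝ) * ρ ^ n ≤ 1 / 48 :=
    t1.eventually_le_const (by norm_num)
  have e2 : ∀ᶠ n : ℕ in Filter.atTop, ρ ^ n ≤ 1 / 48 := t2.eventually_le_const (by norm_num)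
  obtain ⟨n₀, hn₀⟩ := Filter.eventually_atTop.1 (e1.and e2)
  refine ⟨n₀ + 1, fun r hr => ?_⟩
  obtain ⟨h1', h2'⟩ := hn₀ (r - 1) (by omega)
  refine ⟨?_, h2'⟩
  have : (4 * r : ℝ) * ρ ^ (r - 1) = 4 * (((r - 1 : ℕ) : ℝ) * ρ ^ (r - 1)) + 4 * ρ ^ (r - 1) := by
    rw [Nat.cast_sub (by omega : 1 ≤ r)]; push_cast; ring
  rw [this]; linarith

/-- THE FINITE CLAIM on level sets: for `p ∈ (0,1)` there is `K` with `|P[f ∈ X, level] - p P[level]| ≤ K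
|1-2p|^{2r} P[level]` for every `(2r+1) × (2r+1)` grid, level and cell `f` (`K = 6 + ρ̄^{-2r₀}`; exact `0` at `p =
½`). [folklore] -/
theorem level_bias {p : ℝ} (hp0 : 0 < p) (hp1 : p < 1) :
    ∃ K : ℝ, 0 ≤ K ∧ ∀ r : ℕ, 1 ≤ r → ∀ (R C : Finset ℤ), #R = 2 * r + 1 → #C = 2 * r + 1 →
      ∀ X₀, X₀ ⊆ R ×ˢ C → ∀ f ∈ R ×ˢ C,
        |∑ X ∈ lev R C X₀, wt p (R ×ˢ C) X * ((if f ∈ X then 1 else 0) - p)| ≤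
          K * |1 - 2 * p| ^ (2 * r) * ∑ X ∈ lev R C X₀, wt p (R ×ˢ C) X := by
  set ρa := |1 - 2 * p| with hρa
  have h0 : 0 ≤ ρa := abs_nonneg _
  have h1 : ρa < 1 := by rw [hρa]; exact abs_lt.2 ⟨by linarith, by linarith⟩
  have h1' : ρa ≤ 1 := h1.le
  have hpp : p * (1 - p) ≤ 1 / 4 := by nlinarith [sq_nonneg (p - 1 / 2)]
  have hpp0 : 0 ≤ p * (1 - p) := by nlinarith
  obtain ⟨r₀, hr₀⟩ := eventually_small h0 h1
  refine ⟨6 + (ρa ^ (2 * r₀))⁻¹, by positivity, ?_⟩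
  intro r hr R C hR hC X₀ hX₀ f hf
  set P := ∑ X ∈ lev R C X₀, wt p (R ×ˢ C) X with hP
  set B := ∑ X ∈ lev R C X₀, wt p (R ×ˢ C) X * ((if f ∈ X then 1 else 0) - p) with hB
  have hPnn : 0 ≤ P := Finset.sum_nonneg fun X _ => wt_nonneg hp0.le hp1.le _ _
  have hBP : |B| ≤ P := by
    refine (Finset.abs_sum_le_sum_abs _ _).trans (Finset.sum_le_sum fun X _ => ?_)
    rw [abs_mul, abs_of_nonneg (wt_nonneg hp0.le hp1.le _ _)]
    refine mul_le_of_le_one_right (wt_nonneg hp0.le hp1.le _ _) ?_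
    split_ifs <;> rw [abs_le] <;> constructor <;> linarith
  have hZ : (0 : ℝ) < 2 ^ #R * 2 ^ #C := by positivity
  have hT := T_le hR hC hf h0 h1'
  have hZB : 2 ^ #R * 2 ^ #C * |B| ≤
      2 * (p * (1 - p)) * (4 * ρa ^ (2 * r) * (1 + ρa ^ (r - 1)) ^ (4 * r)) := by
    rw [← abs_of_pos hZ, ← abs_mul, hB, levB_eq p R C X₀ hf]
    refine (Finset.abs_sum_le_sum_abs _ _).trans ?_
    refine (Finset.sum_le_sum fun I _ => Finset.abs_sum_le_sum_abs _ _).trans ?_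
    calc _ ≤ ∑ I ∈ R.powerset, ∑ J ∈ C.powerset, 2 * (p * (1 - p)) *
          (if (f.1 ∈ I ↔ f.2 ∈ J) then (0 : ℝ) else ρa ^ (wN R C I J - 1)) := by
          refine Finset.sum_le_sum fun I _ => Finset.sum_le_sum fun J _ => ?_
          rw [abs_mul, abs_sg, one_mul]
          exact absB_le hp0.le hp1.le R C hf I J
      _ = 2 * (p * (1 - p)) * ∑ I ∈ R.powerset, ∑ J ∈ C.powerset,
          (if (f.1 ∈ I ↔ f.2 ∈ J) then (0 : ℝ) else ρa ^ (wN R C I J - 1)) := by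
          simp_rw [Finset.mul_sum]
      _ ≤ _ := mul_le_mul_of_nonneg_left hT (by positivity)
  by_cases hρ : ρa = 0
  · -- p = 1/2: the bias vanishes
    have h2r : ρa ^ (2 * r) = 0 := by rw [hρ]; exact zero_pow (by omega)
    rw [h2r] at hZB ⊢
    have : 2 ^ #R * 2 ^ #C * |B| ≤ 0 := by simpa using hZB
    have hB0 : |B| ≤ 0 := by
      by_contra hcon
      push Not at hcon
      have := mul_pos hZ hcon
      linarith
    simpa using hB0
  have hρpos : 0 < ρa := lt_of_le_of_ne h0 (Ne.symm hρ)
  by_cases hrr : r₀ ≤ r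
  · obtain ⟨c1, c2⟩ := hr₀ r hrr
    have hx3 : (1 + ρa ^ (r - 1)) ^ (4 * r) ≤ 3 := by
      have := one_add_pow_le_inv_sub (ρa ^ (r - 1)) (2 / 3) (by positivity) (4 * r)
        (by push_cast; linarith) (by norm_num)
      norm_num at this; exact this
    have hy : (1 + ρa ^ (r + 1)) ^ (4 * r) ≤ 5 / 4 := by
      have hyx : ρa ^ (r + 1) ≤ ρa ^ (r - 1) := pow_le_pow_of_le_one h0 h1' (by omega)
      have h4 : (0 : ℝ) ≤ 4 * r := by positivity
      have := one_add_pow_le_inv_sub (ρa ^ (r + 1)) (1 / 5) (by positivity) (4 * r)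
        (by push_cast; nlinarith) (by norm_num)
      norm_num at this; exact this
    have h4r : ρa ^ (4 * r) ≤ ρa ^ (r - 1) := pow_le_pow_of_le_one h0 h1' (by omega)
    have h2r : ρa ^ (2 * r) ≤ ρa ^ (r - 1) := pow_le_pow_of_le_one h0 h1' (by omega)
    have hZP : 1 ≤ 2 ^ #R * 2 ^ #C * P := by
      have hge := ZP_ge hp0.le hp1.le hR hC hf hX₀
      rw [← levP_eq, ← hρa] at hge
      have hq : 0 ≤ 2 * ρa ^ (4 * r) + 4 * ρa ^ (2 * r) := by positivity
      have hq' : 2 * ρa ^ (4 * r) + 4 * ρa ^ (2 * r) ≤ 1 / 8 := by linarith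
      have hxx : 0 ≤ (1 + ρa ^ (r - 1)) ^ (4 * r) := by positivity
      nlinarith
    have hfin : 2 ^ #R * 2 ^ #C * |B| ≤ 2 ^ #R * 2 ^ #C * (6 * ρa ^ (2 * r) * P) := by
      have hρ2 : 0 ≤ ρa ^ (2 * r) := by positivity
      calc 2 ^ #R * 2 ^ #C * |B| ≤ 2 * (p * (1 - p)) * (4 * ρa ^ (2 * r) * 3) := by
            refine hZB.trans ?_; gcongr
        _ ≤ 6 * ρa ^ (2 * r) * 1 := by nlinarith
        _ ≤ 6 * ρa ^ (2 * r) * (2 ^ #R * 2 ^ #C * P) := by gcongr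
        _ = _ := by ring
    have := le_of_mul_le_mul_left hfin hZ
    refine this.trans ?_
    have : 0 ≤ (ρa ^ (2 * r₀))⁻¹ * ρa ^ (2 * r) * P := by positivity
    nlinarith
  · -- small r
    push Not at hrr
    have hle : ρa ^ (2 * r₀) ≤ ρa ^ (2 * r) := pow_le_pow_of_le_one h0 h1' (by omega)
    have hpos : 0 < ρa ^ (2 * r₀) := by positivity
    have h1le : 1 ≤ (ρa ^ (2 * r₀))⁻¹ * ρa ^ (2 * r) := by
      rw [le_inv_mul_iff₀ hpos]; simpa using hle
    calc |B| ≤ P := hBP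
      _ ≤ (ρa ^ (2 * r₀))⁻¹ * ρa ^ (2 * r) * P := le_mul_of_one_le_left hPnn h1le
      _ ≤ _ := by
        have : 0 ≤ 6 * ρa ^ (2 * r) * P := by positivity
        nlinarith

/-- `#(X ∩ row i) = #{j ∈ C | (i,j) ∈ X}` for `X ⊆ R × C`. [folklore] -/
theorem card_filter_fst_eq {R C : Finset ℤ} {X : Finset (ℤ × ℤ)} (hX : X ⊆ R ×ˢ C) (i : ℤ) :
    #(X.filter fun c => c.1 = i) = #(C.filter fun j => (i, j) ∈ X) := by
  refine Finset.card_bij' (fun c _ => c.2) (fun j _ => (i, j)) ?_ ?_ ?_ ?_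
  · intro c hc
    rw [Finset.mem_filter] at hc ⊢
    refine ⟨(Finset.mem_product.1 (hX hc.1)).2, ?_⟩
    have : (i, c.2) = c := Prod.ext hc.2.symm rfl
    rw [this]; exact hc.1
  · intro j hj
    rw [Finset.mem_filter] at hj ⊢
    exact ⟨hj.2, rfl⟩
  · intro c hc
    rw [Finset.mem_filter] at hc
    exact Prod.ext hc.2.symm rfl
  · intro j _; rfl

/-- `#(X ∩ column j) = #{i ∈ R | (i,j) ∈ X}` for `X ⊆ R × C`. [folklore] -/
theorem card_filter_snd_eq {R C : Finset ℤ} {X : Finset (ℤ × ℤ)} (hX : X ⊆ R ×ˢ C) (j : ℤ) :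
    #(X.filter fun c => c.2 = j) = #(R.filter fun i => (i, j) ∈ X) := by
  refine Finset.card_bij' (fun c _ => c.1) (fun i _ => (i, j)) ?_ ?_ ?_ ?_
  · intro c hc
    rw [Finset.mem_filter] at hc ⊢
    refine ⟨(Finset.mem_product.1 (hX hc.1)).1, ?_⟩
    have : (c.1, j) = c := Prod.ext rfl hc.2.symm
    rw [this]; exact hc.1
  · intro i hi
    rw [Finset.mem_filter] at hi ⊢
    exact ⟨hi.2, rfl⟩
  · intro c hc
    rw [Finset.mem_filter] at hc
    exact Prod.ext rfl hc.2.symm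
  · intro i _; rfl

/-- Naturals with the same parity have the same image in `ZMod 2`. [folklore] -/
theorem natCast_eq_of_odd_iff {m n : ℕ} (h : Odd m ↔ Odd n) : (m : ZMod 2) = n := by
  rcases Nat.even_or_odd m with hm | hm <;> rcases Nat.even_or_odd n with hn | hn
  · rw [ZMod.natCast_eq_zero_iff_even.2 hm, ZMod.natCast_eq_zero_iff_even.2 hn]
  · exact absurd (h.2 hn) (Nat.not_odd_iff_even.2 hm)
  · exact absurd (h.1 hm) (Nat.not_odd_iff_even.2 hn)
  · rw [ZMod.natCast_eq_one_iff_odd.2 hm, ZMod.natCast_eq_one_iff_odd.2 hn]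

/-- `(-1)^m = (-1)^n` forces `m ≡ n (mod 2)`. [folklore] -/
theorem odd_iff_of_neg_one_pow_eq {m n : ℕ} (h : (-1 : ℝ) ^ m = (-1) ^ n) : (Odd m ↔ Odd n) := by
  rcases Nat.even_or_odd m with hm | hm <;> rcases Nat.even_or_odd n with hn | hn
  · exact iff_of_false (Nat.not_odd_iff_even.2 hm) (Nat.not_odd_iff_even.2 hn)
  · rw [hm.neg_one_pow, hn.neg_one_pow] at h; norm_num at h
  · rw [hm.neg_one_pow, hn.neg_one_pow] at h; norm_num at h
  · exact iff_of_true hm hn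

/-- THE FINITE CLAIM for parity-saturated events: if `E` depends on the pattern only through its row and column
parities (`ZMod 2` sums), then `|Σ_{X ∈ E} wt(X)(1[f∈X] - p)| ≤ K |1-2p|^{2r} Σ_{X ∈ E} wt(X)` (sum of `level_bias`
over the level sets composing `E`). [folklore] -/
theorem sat_bias {p : ℝ} (hp0 : 0 < p) (hp1 : p < 1) :
    ∃ K : ℝ, 0 ≤ K ∧ ∀ r : ℕ, 1 ≤ r → ∀ (R C : Finset ℤ), #R = 2 * r + 1 → #C = 2 * r + 1 →
      ∀ f ∈ R ×ˢ C, ∀ (E : Finset (ℤ × ℤ) → Prop),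
        (∀ X Y, X ⊆ R ×ˢ C → Y ⊆ R ×ˢ C →
          (∀ i ∈ R, (∑ j ∈ C, (if (i, j) ∈ X then (1 : ZMod 2) else 0)) =
            ∑ j ∈ C, (if (i, j) ∈ Y then (1 : ZMod 2) else 0)) →
          (∀ j ∈ C, (∑ i ∈ R, (if (i, j) ∈ X then (1 : ZMod 2) else 0)) =
            ∑ i ∈ R, (if (i, j) ∈ Y then (1 : ZMod 2) else 0)) →
          (E X ↔ E Y)) →
        |∑ X ∈ (R ×ˢ C).powerset.filter E, wt p (R ×ˢ C) X * ((if f ∈ X then 1 else 0) - p)| ≤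
          K * |1 - 2 * p| ^ (2 * r) * ∑ X ∈ (R ×ˢ C).powerset.filter E, wt p (R ×ˢ C) X := by
  obtain ⟨K, hK, hlev⟩ := level_bias hp0 hp1
  refine ⟨K, hK, ?_⟩
  intro r hr R C hR hC f hf E hE
  set S := (R ×ˢ C).powerset.filter E with hS
  set Λ : Finset (ℤ × ℤ) → (↥R → ℝ) × (↥C → ℝ) := fun X => (fun i => rsign i X, fun j => csign j X)
    with hΛ
  have hfib : ∀ g : Finset (ℤ × ℤ) → ℝ,
      ∑ X ∈ S, g X = ∑ y ∈ S.image Λ, ∑ X ∈ S with Λ X = y, g X := fun g =>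
    (Finset.sum_fiberwise_of_maps_to (fun X hX => Finset.mem_image_of_mem Λ hX) g).symm
  have hfibre : ∀ X₀ ∈ S, S.filter (fun X => Λ X = Λ X₀) = lev R C X₀ := by
    intro X₀ hX₀
    obtain ⟨hX₀c, hEX₀⟩ := Finset.mem_filter.1 hX₀
    have hX₀c' : X₀ ⊆ R ×ˢ C := Finset.mem_powerset.1 hX₀c
    ext X
    simp only [hS, lev, Finset.mem_filter, Finset.mem_powerset]
    constructor
    · rintro ⟨⟨hX, -⟩, hΛX⟩
      refine ⟨hX, fun i hi => ?_, fun j hj => ?_⟩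
      · exact congr_fun (congrArg Prod.fst hΛX) ⟨i, hi⟩
      · exact congr_fun (congrArg Prod.snd hΛX) ⟨j, hj⟩
    · rintro ⟨hX, hrow, hcol⟩
      have hΛX : Λ X = Λ X₀ :=
        Prod.ext (funext fun i => hrow i i.2) (funext fun j => hcol j j.2)
      refine ⟨⟨hX, ?_⟩, hΛX⟩
      refine (hE X X₀ hX hX₀c' (fun i hi => ?_) (fun j hj => ?_)).2 hEX₀
      · have := hrow i hi
        rw [rsign_eq_pow, rsign_eq_pow] at this
        rw [Finset.sum_boole, Finset.sum_boole, ← card_filter_fst_eq hX, ← card_filter_fst_eq hX₀c']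
        exact natCast_eq_of_odd_iff (odd_iff_of_neg_one_pow_eq this)
      · have := hcol j hj
        rw [csign_eq_pow, csign_eq_pow] at this
        rw [Finset.sum_boole, Finset.sum_boole, ← card_filter_snd_eq hX, ← card_filter_snd_eq hX₀c']
        exact natCast_eq_of_odd_iff (odd_iff_of_neg_one_pow_eq this)
  rw [hfib, hfib (fun X => wt p (R ×ˢ C) X), Finset.mul_sum]
  refine (Finset.abs_sum_le_sum_abs _ _).trans (Finset.sum_le_sum fun y hy => ?_)
  obtain ⟨X₀, hX₀, rfl⟩ := Finset.mem_image.1 hy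
  rw [hfibre X₀ hX₀]
  exact hlev r hr R C hR hC X₀ (Finset.mem_powerset.1 (Finset.mem_filter.1 hX₀).1) f hf

/-- Reindexing patterns on an injective image. [folklore] -/
theorem sum_powerset_image {α β : Type*} [DecidableEq α] [DecidableEq β] {e : α → β}
    (he : Function.Injective e) (s : Finset α) (g : Finset β → ℝ) :
    ∑ T ∈ (s.image e).powerset, g T = ∑ S ∈ s.powerset, g (S.image e) := by
  rw [Finset.powerset_image, Finset.sum_image]
  intro S _ S' _ h
  exact Finset.image_injective he h

/-- Summing a relative bias bound over sections with nonnegative weights. [folklore] -/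
theorem abs_bias_sum_le {ι κ : Type*} (s : Finset ι) (t : Finset κ) (A B : ι → κ → ℝ) (c p L : ℝ)
    (hc : 0 ≤ c) (h : ∀ i ∈ s, ∀ j ∈ t, |A i j - p * B i j| ≤ L * B i j) :
    |∑ i ∈ s, ∑ j ∈ t, c * A i j - p * ∑ i ∈ s, ∑ j ∈ t, c * B i j| ≤
      L * ∑ i ∈ s, ∑ j ∈ t, c * B i j := by
  calc |∑ i ∈ s, ∑ j ∈ t, c * A i j - p * ∑ i ∈ s, ∑ j ∈ t, c * B i j|
        = |∑ i ∈ s, (∑ j ∈ t, c * A i j - p * ∑ j ∈ t, c * B i j)| := by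
          rw [Finset.sum_sub_distrib, Finset.mul_sum]
    _ ≤ ∑ i ∈ s, |∑ j ∈ t, c * A i j - p * ∑ j ∈ t, c * B i j| := Finset.abs_sum_le_sum_abs _ _
    _ = ∑ i ∈ s, |∑ j ∈ t, (c * A i j - p * (c * B i j))| :=
          Finset.sum_congr rfl fun i _ => by rw [Finset.sum_sub_distrib, Finset.mul_sum]
    _ ≤ ∑ i ∈ s, ∑ j ∈ t, |c * A i j - p * (c * B i j)| :=
          Finset.sum_le_sum fun i _ => Finset.abs_sum_le_sum_abs _ _
    _ ≤ ∑ i ∈ s, ∑ j ∈ t, L * (c * B i j) := by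
          refine Finset.sum_le_sum fun i hi => Finset.sum_le_sum fun j hj => ?_
          rw [show c * A i j - p * (c * B i j) = c * (A i j - p * B i j) by ring, abs_mul,
            abs_of_nonneg hc]
          nlinarith [h i hi j hj]
    _ = L * ∑ i ∈ s, ∑ j ∈ t, c * B i j := by
          rw [Finset.mul_sum]
          exact Finset.sum_congr rfl fun i _ => by rw [Finset.mul_sum]

end SyndromeBias

end Summit.CriticalPhenomena.CardyFormulaZ2.Theorems.CornerLineDescent.SymmetricSeed
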